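import Summits.ValiantsHypothesis.ValiantsHypothesis.Theorems.LacunarySymmetroidMatrixDescartesCensusDoorA34NullNullEndCells

/-!
# `MatrixDescartes` census — DOOR A at `(3,4)`: the END-CELL DICHOTOMY of the null-null sheet, SUPPORT-FREE — on EVERY sorted support a null-null
# seventeen cannot have both «same-sign semidefinite ends» and «opposite-sign semidefinite ends» available: one of the two configurations is excluded

HONEST FRAMING.  Object-search cell `pub-symmetroid`, engine seat `val-sym-eng-2` (g6); helper row beside the registered strata line
`Cruxes/DoorA34/Lines/strata.lean` on stmt-ValiantsHypothesis-19980 (`DoorA34 = PosRootLawAt 3 4 18`: OPEN, typed, never asserted here), stub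
`stub_nullNullCeiling` (`det S₀ = det S₃ = 0 ⇒ ≤ 16`).  …NullNullEndCells (g5) proves four parity-conditioned closures: with both singular end letters
semidefinite OF THE SAME SIGN a seventeen needs the end slots `{0,0,3}`, `{0,3,3}` to have null-null sheet ranks of EQUAL parity, with OPPOSITE signs of
DIFFERENT parity.  The per-chamber files …NullNullChamberEndsA–E say which alternative holds on each of the 80 exponent chambers.  This file records the
chamber-free consequence, valid for EVERY sorted support with no rank computation at all (excluded middle on the parity):

* **`nullNull_endCell_dichotomy`** — for every `StrictMono d` and symmetric letters with `det S₀ = det S₃ = 0`: EITHER every pencil of this support whose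
  two end letters are semidefinite of the same sign has `Z₊ ≤ 16`, OR every pencil of this support whose end letters are semidefinite of opposite signs has
  `Z₊ ≤ 16` (the alternative depends on `d` only);
* `card_posRoots_le_16_of_nullNull_semidefEnds_of_parity` — the pointwise form: if the two parities are equal, opposite-sign ends give `≤ 16`; if different,
  same-sign ends give `≤ 16`.

Nothing here bounds anything else (the doubly-indefinite cell — the cell of every null-null object of record — is untouched); `DoorA34` and the three stubs stay
OPEN; registers unchanged; nothing on `MatrixDescartes` (stmt-ValiantsHypothesis-18050) or `VP ≠ VNP` — VP≠VNP not moved.  [folklore] bookkeeping.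
-/

-- `Summit.ValiantsHypothesis.ValiantsHypothesis.…` repeats a component by the D-0017 layout
-- (single-conjunct summit), which the `dupNamespace` linter flags; the name is mandated.
set_option linter.dupNamespace false

namespace Summit.ValiantsHypothesis.ValiantsHypothesis.Theorems.LacunarySymmetroidMatrixDescartes.Census

open Polynomial Finset Matrix
open scoped BigOperators Polynomial Matrix

/-- **Pointwise form of the end-cell dichotomy.**  Sorted support, symmetric letters, `det S₀ = det S₃ = 0`, `ρ` the null-null sheet rank: if
`ρ(2d₀+d₃)` and `ρ(2d₃+d₀)` have EQUAL parity then opposite-sign semidefinite ends give `Z₊ ≤ 16`; if DIFFERENT parity then same-sign semidefinite ends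
give `Z₊ ≤ 16`. [folklore] -/
theorem card_posRoots_le_16_of_nullNull_semidefEnds_of_parity (d : Fin 4 → ℕ) (hd : StrictMono d) (S : Fin 4 → Matrix (Fin 3) (Fin 3) ℝ)
    (hS : ∀ l, (S l).IsSymm) (h0 : (S 0).det = 0) (h3 : (S 3).det = 0)
    (ρ : ℕ → ℕ) (hρ : ∀ n, ρ n = ((((((Finset.univ : Finset (Sym (Fin 4) 3)).erase (Sym.replicate 3 3)).erase (Sym.replicate 3 0)).image
          (fun s : Sym (Fin 4) 3 => ((s : Multiset (Fin 4)).map d).sum)).filter (· < n)).card)) :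
    ((ρ (2 * d 0 + d 3) % 2 = ρ (2 * d 3 + d 0) % 2) →
        (((S 0).PosSemidef ∧ (-(S 3)).PosSemidef) ∨ ((-(S 0)).PosSemidef ∧ (S 3).PosSemidef)) →
        ((Matrix.det (∑ l, ((X : ℝ[X]) ^ d l) • (S l).map C)).roots.toFinset.filter (fun t => 0 < t)).card ≤ 16) ∧
    ((ρ (2 * d 0 + d 3) % 2 ≠ ρ (2 * d 3 + d 0) % 2) →
        (((S 0).PosSemidef ∧ (S 3).PosSemidef) ∨ ((-(S 0)).PosSemidef ∧ (-(S 3)).PosSemidef)) →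
        ((Matrix.det (∑ l, ((X : ℝ[X]) ^ d l) • (S l).map C)).roots.toFinset.filter (fun t => 0 < t)).card ≤ 16) := by
  refine ⟨fun hpar hends => ?_, fun hpar hends => ?_⟩
  · rcases hends with ⟨hp0, hn3⟩ | ⟨hn0, hp3⟩
    · exact card_posRoots_le_16_of_nullNull_psd_nsd d hd S hS h0 h3 hp0 hn3 ρ hρ hpar
    · exact card_posRoots_le_16_of_nullNull_nsd_psd d hd S hS h0 h3 hn0 hp3 ρ hρ hpar
  · rcases hends with ⟨hp0, hp3⟩ | ⟨hn0, hn3⟩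
    · exact card_posRoots_le_16_of_nullNull_psd_psd d hd S hS h0 h3 hp0 hp3 ρ hρ hpar
    · exact card_posRoots_le_16_of_nullNull_nsd_nsd d hd S hS h0 h3 hn0 hn3 ρ hρ hpar

/-- **END-CELL DICHOTOMY, SUPPORT-FREE.**  For EVERY sorted support `d` (the alternative depends on `d` only): EITHER all null-null pencils on `d`
(symmetric letters, `det S₀ = det S₃ = 0`) whose singular end letters are semidefinite of the SAME sign have at most `16` distinct positive roots, OR
all those whose end letters are semidefinite of OPPOSITE signs do. [folklore] -/
theorem nullNull_endCell_dichotomy (d : Fin 4 → ℕ) (hd : StrictMono d) :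
    (∀ S : Fin 4 → Matrix (Fin 3) (Fin 3) ℝ, (∀ l, (S l).IsSymm) → (S 0).det = 0 → (S 3).det = 0 →
        (((S 0).PosSemidef ∧ (S 3).PosSemidef) ∨ ((-(S 0)).PosSemidef ∧ (-(S 3)).PosSemidef)) →
        ((Matrix.det (∑ l, ((X : ℝ[X]) ^ d l) • (S l).map C)).roots.toFinset.filter (fun t => 0 < t)).card ≤ 16) ∨
    (∀ S : Fin 4 → Matrix (Fin 3) (Fin 3) ℝ, (∀ l, (S l).IsSymm) → (S 0).det = 0 → (S 3).det = 0 →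
        (((S 0).PosSemidef ∧ (-(S 3)).PosSemidef) ∨ ((-(S 0)).PosSemidef ∧ (S 3).PosSemidef)) →
        ((Matrix.det (∑ l, ((X : ℝ[X]) ^ d l) • (S l).map C)).roots.toFinset.filter (fun t => 0 < t)).card ≤ 16) := by
  obtain ⟨ρ, hρ⟩ : ∃ ρ : ℕ → ℕ, ∀ n, ρ n = (((((Finset.univ : Finset (Sym (Fin 4) 3)).erase (Sym.replicate 3 3)).erase (Sym.replicate 3 0)).image
      (fun s : Sym (Fin 4) 3 => ((s : Multiset (Fin 4)).map d).sum)).filter (· < n)).card := ⟨_, fun _ => rfl⟩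
  by_cases hpar : ρ (2 * d 0 + d 3) % 2 = ρ (2 * d 3 + d 0) % 2
  · exact Or.inr fun S hS h0 h3 hends => (card_posRoots_le_16_of_nullNull_semidefEnds_of_parity d hd S hS h0 h3 ρ hρ).1 hpar hends
  · exact Or.inl fun S hS h0 h3 hends => (card_posRoots_le_16_of_nullNull_semidefEnds_of_parity d hd S hS h0 h3 ρ hρ).2 hpar hends

end Summit.ValiantsHypothesis.ValiantsHypothesis.Theorems.LacunarySymmetroidMatrixDescartes.Census
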